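import Literature.Analysis.FluidPDE.PassiveScalarReleasePairing
import Literature.Analysis.FluidPDE.SourcedScalarBudget
import HarnessLib

/-!
# Grid age decoupling, II: the pairing inequalities at grid release times, a.e. in the observation time

Analysis/FluidPDE proof-support file (everything proved). For `κ > 0`, a GLOBAL weak solution `θ`
of the steadily sourced equation `∂ₜθ + u·∇θ = κΔθ + h` (`Torus.IsWeakScalarTransportForced`) over
a drift with `∫₀ᵀ ‖∇u‖_{L²} < ∞` for every `T`, and a countable family `ϑ n` of BOUNDED weak
releases of the source profile `h` at the grid times `s_n = δ(n+1)` (weak solutions of the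
homogeneous equation driven by `u(s_n + ·)` on `[0, S+1)`), the two pairing inequalities of
`PassiveScalarReleasePairing.ae_pairing_bound` are put in the REAL form consumed by the grid
age-decoupling argument, simultaneously for all releases, for a.e. observation time `t`:

* (P1) `ae_forall_scalar_release_pairing`: for a.e. `t`, for every `n` with age
  `τ = t - s_n ∈ (0, S]` (`t ≥ S`),
  `P(s_n) ≤ ∫ θ(t) ϑ_n(τ) - ∫_{(0,τ]} ∫ ϑ_n h + 2 √(∫_{t-S}^t κ‖∇θ‖²) √D_n`,
  `P` the trace of the power input, `D_n = (eScalarDissipation κ ϑ_n 0 S).toReal`;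
* (P2) `ae_forall_release_release_pairing`: for a.e. `t`, for all `n`, `m` with
  `t - s_{n+m+1} > 0` and `t - s_n ≤ S`,
  `∫ ϑ_n(t - s_n) ϑ_{n+m+1}(t - s_{n+m+1}) - 2 √D_n √D_{n+m+1} ≤ P_{ϑ_n}(δ(m+1))`,
  `P_{ϑ_n}` the trace of `τ ↦ ∫ ϑ_n(τ) h`.

"A.e. `τ`" of the pairing bound becomes "a.e. `t`, all releases" because the family is countable:
each statement is transported along `t ↦ t - s_n` (`ae_sub_mem_Ioo_imp`) and intersected
(`ae_all_iff`). Also: the slices `ϑ_n(t - s_n)` are in `L²` with `‖ϑ_n(t - s_n)‖² ≤ ∫h²` for a.e.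
`t` and all `n` (`ae_forall_release_slice`), and a release dissipates at most half the variance of
its datum (`toReal_eScalarDissipation_le_half`).

## References

* R. J. DiPerna, P.-L. Lions, Invent. Math. 98 (1989), §II.3 Thm. II.3. [`DiPernaLions1989`]
* T. D. Drivas, T. M. Elgindi, G. Iyer, I.-J. Jeong, ARMA 243 (2022), (1.1)–(1.3). [`DEIJ2022`]
-/

noncomputable section

open _root_.MeasureTheory _root_.Set _root_.Filter _root_.Function _root_.TopologicalSpace
open scoped ENNReal NNReal InnerProductSpace

namespace Literature.Analysis.FluidPDE

namespace Torus

variable {d : Type*} [Fintype d]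

/-! ## Transport of a.e. statements to ages, and the real form of a pairing bound -/

omit [Fintype d] in
/-- An a.e. statement on `(0, T')` holds at the ages `t - σ`, for a.e. `t` (translation invariance
of Lebesgue measure). [folklore] -/
theorem ae_sub_mem_Ioo_imp {T' σ : ℝ} {Q : ℝ → Prop}
    (h : ∀ᵐ τ ∂((volume : Measure ℝ).restrict (Ioo 0 T')), Q τ) :
    ∀ᵐ t ∂(volume : Measure ℝ), t - σ ∈ Ioo 0 T' → Q (t - σ) := by
  rw [ae_restrict_iff' measurableSet_Ioo] at h
  exact (measurePreserving_sub_right volume σ).quasiMeasurePreserving.ae h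

omit [Fintype d] in
/-- **Real form of a pairing bound**: from `ofReal |X| ≤ 2 D_a^{1/2} D_b^{1/2}` and
`D_a ≤ D_a' < ∞`, `D_b ≤ D_b' < ∞` one gets `|X| ≤ 2 √(D_a'.toReal) √(D_b'.toReal)`. [folklore] -/
theorem abs_le_two_mul_sqrt_of_pairing {X : ℝ} {Da Db Da' Db' : ℝ≥0∞}
    (h : ENNReal.ofReal |X| ≤ 2 * Da ^ (1 / 2 : ℝ) * Db ^ (1 / 2 : ℝ))
    (ha : Da ≤ Da') (hb : Db ≤ Db') (ha' : Da' ≠ ⊤) (hb' : Db' ≠ ⊤) :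
    |X| ≤ 2 * Real.sqrt Da'.toReal * Real.sqrt Db'.toReal := by
  have h1 : ENNReal.ofReal |X| ≤ 2 * Da' ^ (1 / 2 : ℝ) * Db' ^ (1 / 2 : ℝ) :=
    h.trans (by gcongr)
  have hfin : 2 * Da' ^ (1 / 2 : ℝ) * Db' ^ (1 / 2 : ℝ) ≠ ⊤ :=
    ENNReal.mul_ne_top (ENNReal.mul_ne_top ENNReal.ofNat_ne_top
      (ENNReal.rpow_ne_top_of_nonneg (by norm_num) ha')) (ENNReal.rpow_ne_top_of_nonneg (by norm_num) hb')
  have h2 := ENNReal.toReal_mono hfin h1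
  rw [ENNReal.toReal_ofReal (abs_nonneg _), ENNReal.toReal_mul, ENNReal.toReal_mul,
    ← ENNReal.toReal_rpow, ← ENNReal.toReal_rpow, ENNReal.toReal_ofNat] at h2
  rwa [Real.sqrt_eq_rpow, Real.sqrt_eq_rpow]

/-- For `f ∈ L²(T^d)`: `ofReal (scalarL2Sq f) = ∫⁻ ‖f‖ₑ²`. [folklore] -/
theorem ofReal_scalarL2Sq_eq {f : UnitAddTorus d → ℝ} (hf : MemLp f 2 volume) :
    ENNReal.ofReal (scalarL2Sq f) = ∫⁻ x, ‖f x‖ₑ ^ 2 := by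
  -- adapted from Literature/Analysis/FluidPDE/SourcedScalarBudget.lean (`integrableOn_scalarL2Sq`)
  rw [scalarL2Sq, ofReal_integral_eq_lintegral_ofReal hf.integrable_sq (ae_of_all _ fun x => sq_nonneg _)]
  refine lintegral_congr fun x => ?_
  rw [Real.enorm_eq_ofReal_abs, ← ENNReal.ofReal_pow (abs_nonneg _), sq_abs]

/-- An `L²` slice bound in `lintegral` form is a bound of `scalarL2Sq`: if `f, h ∈ L²` and
`∫⁻ ‖f‖ₑ² ≤ ‖h‖_{L²}²` then `scalarL2Sq f ≤ ∫ h²`. [folklore] -/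
theorem scalarL2Sq_le_of_lintegral_le {f h : UnitAddTorus d → ℝ} (hf : MemLp f 2 volume)
    (hh : MemLp h 2 volume) (hle : ∫⁻ x, ‖f x‖ₑ ^ 2 ≤ eLpNorm h 2 volume ^ 2) :
    scalarL2Sq f ≤ ∫ y, h y ^ 2 := by
  rw [FunctionSpaces.eLpNorm_two_pow_two_eq_lintegral, ← ofReal_scalarL2Sq_eq hf, ← ofReal_scalarL2Sq_eq hh] at hle
  exact (ENNReal.ofReal_le_ofReal_iff (integral_nonneg fun _ => sq_nonneg _)).1 hle

namespace IsWeakScalarTransportOn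

variable {Tb κ : ℝ} {w : ℝ → UnitAddTorus d → EuclideanSpace ℝ d} {a₀ : UnitAddTorus d → ℝ}
  {R : ℝ → UnitAddTorus d → ℝ}

/-! ## The dissipation of a release in real form -/

/-- **A release dissipates at most half the variance of its datum** (real form): for `κ > 0`,
`a₀ ∈ L²` and a drift with `∫₀^{T_b} ‖∇w‖_{L²} < ∞`, for every `S ≤ T_b`,
`eScalarDissipation κ R 0 S < ∞` and `(eScalarDissipation κ R 0 S).toReal ≤ ½ ∫ a₀²`.
[cite: DiPernaLions1989, §II.3 Thm. II.3] -/
theorem toReal_eScalarDissipation_le_half (hκ : 0 < κ) (hR : IsWeakScalarTransportOn Tb κ w a₀ R)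
    (ha₀ : MemLp a₀ 2 volume)
    (hG : ∫⁻ t in Ioo 0 Tb, FunctionSpaces.Torus.eGradNormSq (w t) ^ (1 / 2 : ℝ) < ⊤) {S : ℝ} (hS : S ≤ Tb) :
    eScalarDissipation κ R 0 S < ⊤ ∧ (eScalarDissipation κ R 0 S).toReal ≤ (1 / 2) * ∫ y, a₀ y ^ 2 := by
  have hE := hR.energy_ineq_of_lintegral_eGradNormSq_rpow_lt_top hκ ha₀ hG
  rw [← ofReal_scalarL2Sq_eq ha₀] at hE
  have hmono : eScalarDissipation κ R 0 S ≤ eScalarDissipation κ R 0 Tb := by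
    unfold eScalarDissipation
    exact mul_le_mul' le_rfl (lintegral_mono_set (Ioo_subset_Ioo_right hS))
  have h0 : 0 ≤ scalarL2Sq a₀ := integral_nonneg fun _ => sq_nonneg _
  have hle : eScalarDissipation κ R 0 S ≤ ENNReal.ofReal (scalarL2Sq a₀ / 2) := by
    have e2 : ENNReal.ofReal (scalarL2Sq a₀) = 2 * ENNReal.ofReal (scalarL2Sq a₀ / 2) := by
      rw [← ENNReal.ofReal_ofNat 2, ← ENNReal.ofReal_mul zero_le_two]
      congr 1; ring
    rw [e2] at hE
    exact hmono.trans ((ENNReal.mul_le_mul_iff_right two_ne_zero ENNReal.ofNat_ne_top).1 hE)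
  refine ⟨hle.trans_lt ENNReal.ofReal_lt_top, ?_⟩
  have := ENNReal.toReal_mono ENNReal.ofReal_ne_top hle
  rw [ENNReal.toReal_ofReal (by positivity)] at this
  rw [scalarL2Sq] at this
  linarith

end IsWeakScalarTransportOn

/-! ## The countable family of grid releases: slices and strain windows -/

section Family

variable {κ δ S B : ℝ} {u : ℝ → UnitAddTorus d → EuclideanSpace ℝ d} {h θ₀ : UnitAddTorus d → ℝ}
  {θ : ℝ → UnitAddTorus d → ℝ} {ϑ : ℕ → ℝ → UnitAddTorus d → ℝ}

/-- The windowed strain `∫⁻_{(0,c)} ‖∇u(s + τ)‖₂ dτ` of a drift with `∫₀ᵀ ‖∇u‖₂ < ∞` for all `T`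
is finite (`s ≥ 0`). [folklore] -/
theorem lintegral_rpow_half_translate_lt_top
    (hG : ∀ T, 0 < T → ∫⁻ t in Ioo 0 T, FunctionSpaces.Torus.eGradNormSq (u t) ^ (1 / 2 : ℝ) < ⊤)
    {s c : ℝ} (hs : 0 ≤ s) (hc : 0 < c) :
    ∫⁻ τ in Ioo 0 c, FunctionSpaces.Torus.eGradNormSq (u (s + τ)) ^ (1 / 2 : ℝ) < ⊤ :=
  (setLIntegral_comp_add_left_le (F := fun t => FunctionSpaces.Torus.eGradNormSq (u t) ^ (1 / 2 : ℝ)) hs le_rfl).trans_lt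
    (hG (s + c) (by linarith))

/-- **Slices of the releases at the ages `t - s_n` are in `L²` with `‖ϑ_n(t - s_n)‖² ≤ ∫ h²`**,
for a.e. `t`, simultaneously for all `n` with `t - s_n ∈ (0, S+1)` (countable family, translation
invariance). [folklore] -/
theorem ae_forall_release_slice (hh : FunctionSpaces.Torus.IsSmooth h)
    (hrel : ∀ n : ℕ, IsWeakScalarTransportOn (S + 1) κ (fun τ => u (δ * (n + 1) + τ)) h (ϑ n))
    (hsq : ∀ n : ℕ, ∀ᵐ τ ∂((volume : Measure ℝ).restrict (Ioo 0 (S + 1))),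
      ∫⁻ x, ‖ϑ n τ x‖ₑ ^ 2 ≤ eLpNorm h 2 volume ^ 2) :
    ∀ᵐ t ∂(volume : Measure ℝ), ∀ n : ℕ, t - δ * (n + 1) ∈ Ioo 0 (S + 1) →
      MemLp (ϑ n (t - δ * (n + 1))) 2 volume ∧ scalarL2Sq (ϑ n (t - δ * (n + 1))) ≤ ∫ y, h y ^ 2 := by
  refine ae_all_iff.2 fun n => ?_
  have h1 : ∀ᵐ τ ∂((volume : Measure ℝ).restrict (Ioo 0 (S + 1))),
      MemLp (ϑ n τ) 2 volume ∧ scalarL2Sq (ϑ n τ) ≤ ∫ y, h y ^ 2 := by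
    filter_upwards [(hrel n).ae_memLp_two, hsq n] with τ hm hs
    exact ⟨hm, scalarL2Sq_le_of_lintegral_le hm (hh.memLp 2) hs⟩
  exact ae_sub_mem_Ioo_imp h1

/-- The slices of a global sourced weak solution are in `L²` for a.e. `t > 0`. [folklore] -/
theorem ae_memLp_two_Ioi {s : ℝ → UnitAddTorus d → ℝ} (hθ : IsWeakScalarTransportForced κ u s θ₀ θ) :
    ∀ᵐ t ∂((volume : Measure ℝ).restrict (Ioi 0)), MemLp (θ t) 2 volume := by
  -- adapted from Literature/Analysis/FluidPDE/SourcedScalarBudget.lean (`ae_trace_sq_le`)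
  rw [Ioi_zero_eq_iUnion_Ioo_nat, ae_restrict_iUnion_iff]
  intro n
  rcases Nat.eq_zero_or_pos n with hn | hn
  · subst hn; simp
  · exact (hθ n (by exact_mod_cast hn)).ae_memLp_two

/-! ## (P1): the sourced scalar paired with the grid releases -/

/-- **(P1), real form, a.e. in the observation time.** For a.e. `t`, for every release `ϑ_n`
(started at `s_n = δ(n+1)`) whose age `τ = t - s_n` lies in `(0, S]`, with `t ≥ S`:
`P(s_n) ≤ ∫ θ(t) ϑ_n(τ) - ∫_{(0,τ]} ∫ ϑ_n(τ') h dτ' + 2 √(∫_{t-S}^t κ‖∇θ‖²) √D_n`, where `P` is the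
trace of the power input `t ↦ ∫ θ(t) h` and `D_n = (eScalarDissipation κ ϑ_n 0 S).toReal`
(`ae_pairing_bound` with `a = θ` on the horizons `N ∈ ℕ`, `b = ϑ_n`, transported along
`t ↦ t - s_n`; the dissipation windows are enlarged to `(t - S, t)` and `(0, S)`).
[cite: DiPernaLions1989, §II.3 Thm. II.3] -/
theorem ae_forall_scalar_release_pairing (hκ : 0 < κ)
    (hθ : IsWeakScalarTransportForced κ u (fun _ => h) θ₀ θ) (hθ₀ : MemLp θ₀ 2 volume)
    (hh : FunctionSpaces.Torus.IsSmooth h)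
    (hG : ∀ T, 0 < T → ∫⁻ t in Ioo 0 T, FunctionSpaces.Torus.eGradNormSq (u t) ^ (1 / 2 : ℝ) < ⊤)
    (hδ : 0 < δ) (hS : 0 < S)
    (hrel : ∀ n : ℕ, IsWeakScalarTransportOn (S + 1) κ (fun τ => u (δ * (n + 1) + τ)) h (ϑ n))
    (hB : ∀ n : ℕ, ∀ᵐ τ ∂((volume : Measure ℝ).restrict (Ioo 0 (S + 1))),
      ∀ᵐ x ∂(volume : Measure (UnitAddTorus d)), |ϑ n τ x| ≤ B) :
    ∀ᵐ t ∂(volume : Measure ℝ), ∀ n : ℕ, S ≤ t → 0 < t - δ * (n + 1) → t - δ * (n + 1) ≤ S →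
      (∫ y, θ₀ y * h y) + ∫ τ in Ioc 0 (δ * (n + 1)), ((∫ y, θ τ y *
          (⟪u τ y, FunctionSpaces.Torus.gradient h y⟫_ℝ + κ * FunctionSpaces.Torus.laplacian h y)) + ∫ y, h y * h y) ≤
        (∫ x, θ t x * ϑ n (t - δ * (n + 1)) x) - (∫ τ in Ioc 0 (t - δ * (n + 1)), ∫ y, ϑ n τ y * h y) +
          2 * Real.sqrt (∫ s in (t - S)..t, κ * (eScalarGradNormSq (θ s)).toReal) *
            Real.sqrt (eScalarDissipation κ (ϑ n) 0 S).toReal := by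
  -- the `ℝ≥0∞` bound for every release and every integer horizon, a.e. in `t`
  have hae : ∀ᵐ t ∂(volume : Measure ℝ), ∀ n N : ℕ,
      t - δ * (n + 1) ∈ Ioo 0 (min (S + 1) (N - δ * (n + 1))) →
      ENNReal.ofReal |(∫ x, θ t x * ϑ n (t - δ * (n + 1)) x) -
          ((∫ y, θ₀ y * h y) + ∫ τ in Ioc 0 (δ * (n + 1)), ((∫ y, θ τ y *
            (⟪u τ y, FunctionSpaces.Torus.gradient h y⟫_ℝ + κ * FunctionSpaces.Torus.laplacian h y)) + ∫ y, h y * h y)) -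
          ∫ τ' in Ioc 0 (t - δ * (n + 1)), ∫ y, ϑ n τ' y * h y| ≤
        2 * eScalarDissipation κ θ (δ * (n + 1)) t ^ (1 / 2 : ℝ) *
          eScalarDissipation κ (ϑ n) 0 (t - δ * (n + 1)) ^ (1 / 2 : ℝ) := by
    refine ae_all_iff.2 fun n => ae_all_iff.2 fun N => ?_
    have hσ0 : 0 ≤ δ * (n + 1) := by positivity
    rcases lt_or_ge (δ * (n + 1)) N with hσN | hσN
    · have hN : (0 : ℝ) < N := hσ0.trans_lt hσN
      have h1 := (hθ N hN).ae_pairing_bound hκ.le hθ₀ hh (hG N hN) hσ0 hσN (by linarith : (0 : ℝ) < S + 1)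
        hh (hrel n) (hB n)
      filter_upwards [ae_sub_mem_Ioo_imp (σ := δ * (n + 1)) h1] with t ht hmem
      have h3 := ht hmem
      simp only [add_sub_cancel] at h3
      exact h3
    · refine ae_of_all _ fun t hmem => ?_
      have h4 : t - δ * (n + 1) < N - δ * (n + 1) := hmem.2.trans_le (min_le_right _ _)
      linarith [hmem.1]
  filter_upwards [hae] with t ht n hSt hage hageS
  obtain ⟨N, hN⟩ := exists_nat_gt t
  have hmem : t - δ * (n + 1) ∈ Ioo 0 (min (S + 1) (N - δ * (n + 1))) :=
    ⟨hage, lt_min (by linarith) (by linarith)⟩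
  have hbound := ht n N hmem
  -- the enlarged windows are finite
  have hσ0 : 0 ≤ δ * (n + 1) := by positivity
  obtain ⟨hfinθ, heqθ⟩ := intervalIntegral_dissipationRate_eq hκ hθ hθ₀ hh hG (by linarith : (0 : ℝ) ≤ t - S)
    (by linarith : t - S ≤ t)
  have hDa : eScalarDissipation κ θ (δ * (n + 1)) t ≤ eScalarDissipation κ θ (t - S) t := by
    unfold eScalarDissipation
    exact mul_le_mul' le_rfl (lintegral_mono_set (Ioo_subset_Ioo_left (by linarith)))
  have hDa' : eScalarDissipation κ θ (t - S) t ≠ ⊤ := by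
    unfold eScalarDissipation; exact ENNReal.mul_ne_top ENNReal.ofReal_ne_top hfinθ.ne
  have hGn := lintegral_rpow_half_translate_lt_top hG hσ0 (by linarith : (0 : ℝ) < S + 1)
  obtain ⟨hDbfin, -⟩ := (hrel n).toReal_eScalarDissipation_le_half hκ (hh.memLp 2) hGn (by linarith : S ≤ S + 1)
  have hDb : eScalarDissipation κ (ϑ n) 0 (t - δ * (n + 1)) ≤ eScalarDissipation κ (ϑ n) 0 S := by
    unfold eScalarDissipation
    exact mul_le_mul' le_rfl (lintegral_mono_set (Ioo_subset_Ioo_right hageS))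
  have hreal := abs_le_two_mul_sqrt_of_pairing hbound hDa hDb hDa' hDbfin.ne
  have e1 : (eScalarDissipation κ θ (t - S) t).toReal = ∫ s in (t - S)..t, κ * (eScalarGradNormSq (θ s)).toReal := by
    rw [heqθ]; unfold eScalarDissipation; rw [ENNReal.toReal_mul, ENNReal.toReal_ofReal hκ.le]
  rw [e1] at hreal
  linarith [(abs_le.1 hreal).1]

/-! ## (P2): two grid releases paired with each other -/

/-- **(P2), real form, a.e. in the observation time.** For a.e. `t`, for all `n`, `m` with
`t - s_{n+m+1} > 0` and `t - s_n ≤ S` (`s_k = δ(k+1)`):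
`∫ ϑ_n(t - s_n) ϑ_{n+m+1}(t - s_{n+m+1}) - 2 √D_n √D_{n+m+1} ≤ P_{ϑ_n}(δ(m+1))`, where
`P_{ϑ_n}(σ) = ∫ h² + ∫_{(0,σ]} ∫ ϑ_n (⟪u(s_n + ·), ∇h⟫ + κΔh)` is the trace of `σ ↦ ∫ ϑ_n(σ) h` and
`D_k = (eScalarDissipation κ ϑ_k 0 S).toReal` (`ae_pairing_bound` with `a = ϑ_n` as a sourced
solution with zero source over `u(s_n + ·)`, `b = ϑ_{n+m+1}` released at `σ = δ(m+1)` on `a`'s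
clock, transported along `t ↦ t - s_{n+m+1}`). [cite: DiPernaLions1989, §II.3 Thm. II.3] -/
theorem ae_forall_release_release_pairing (hκ : 0 < κ) (hh : FunctionSpaces.Torus.IsSmooth h)
    (hG : ∀ T, 0 < T → ∫⁻ t in Ioo 0 T, FunctionSpaces.Torus.eGradNormSq (u t) ^ (1 / 2 : ℝ) < ⊤)
    (hδ : 0 < δ) (hS : 0 < S)
    (hrel : ∀ n : ℕ, IsWeakScalarTransportOn (S + 1) κ (fun τ => u (δ * (n + 1) + τ)) h (ϑ n))
    (hB : ∀ n : ℕ, ∀ᵐ τ ∂((volume : Measure ℝ).restrict (Ioo 0 (S + 1))),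
      ∀ᵐ x ∂(volume : Measure (UnitAddTorus d)), |ϑ n τ x| ≤ B) :
    ∀ᵐ t ∂(volume : Measure ℝ), ∀ n m : ℕ, 0 < t - δ * ((n + m + 1 : ℕ) + 1) → t - δ * (n + 1) ≤ S →
      (∫ x, ϑ n (t - δ * (n + 1)) x * ϑ (n + m + 1) (t - δ * ((n + m + 1 : ℕ) + 1)) x) -
          2 * Real.sqrt (eScalarDissipation κ (ϑ n) 0 S).toReal *
            Real.sqrt (eScalarDissipation κ (ϑ (n + m + 1)) 0 S).toReal ≤
        (∫ y, h y * h y) + ∫ r in Ioc 0 (δ * (m + 1)), ∫ y, ϑ n r y *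
          (⟪u (δ * (n + 1) + r) y, FunctionSpaces.Torus.gradient h y⟫_ℝ + κ * FunctionSpaces.Torus.laplacian h y) := by
  have hae : ∀ᵐ t ∂(volume : Measure ℝ), ∀ n m : ℕ, δ * (m + 1) < S + 1 →
      t - δ * ((n + m + 1 : ℕ) + 1) ∈ Ioo 0 (min (S + 1) (S + 1 - δ * (m + 1))) →
      ENNReal.ofReal |(∫ x, ϑ n (δ * (m + 1) + (t - δ * ((n + m + 1 : ℕ) + 1))) x *
            ϑ (n + m + 1) (t - δ * ((n + m + 1 : ℕ) + 1)) x) -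
          ((∫ y, h y * h y) + ∫ r in Ioc 0 (δ * (m + 1)), ∫ y, ϑ n r y *
            (⟪u (δ * (n + 1) + r) y, FunctionSpaces.Torus.gradient h y⟫_ℝ + κ * FunctionSpaces.Torus.laplacian h y))| ≤
        2 * eScalarDissipation κ (ϑ n) (δ * (m + 1)) (δ * (m + 1) + (t - δ * ((n + m + 1 : ℕ) + 1))) ^ (1 / 2 : ℝ) *
          eScalarDissipation κ (ϑ (n + m + 1)) 0 (t - δ * ((n + m + 1 : ℕ) + 1)) ^ (1 / 2 : ℝ) := by
    refine ae_all_iff.2 fun n => ae_all_iff.2 fun m => ?_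
    by_cases hσT : δ * (m + 1) < S + 1
    · have hσ0 : 0 ≤ δ * (m + 1) := by positivity
      have hs₀ : 0 ≤ δ * (n + 1) := by positivity
      have ha : IsWeakScalarTransportForcedOn (S + 1) κ (fun r => u (δ * (n + 1) + r))
          (fun _ => (0 : UnitAddTorus d → ℝ)) h (ϑ n) :=
        isWeakScalarTransportForcedOn_zero_iff.2 (hrel n)
      have hGn := lintegral_rpow_half_translate_lt_top hG hs₀ (by linarith : (0 : ℝ) < S + 1)
      have hdrift : (fun τ => (fun r => u (δ * (n + 1) + r)) (δ * (m + 1) + τ)) =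
          fun τ => u (δ * ((n + m + 1 : ℕ) + 1) + τ) := by
        funext τ; push_cast; ring_nf
      have hb : IsWeakScalarTransportOn (S + 1) κ (fun τ => (fun r => u (δ * (n + 1) + r)) (δ * (m + 1) + τ)) h
          (ϑ (n + m + 1)) := by
        rw [hdrift]; exact hrel (n + m + 1)
      have h1 := ha.ae_pairing_bound hκ.le (hh.memLp 2) (FunctionSpaces.Torus.isSmooth_const (0 : ℝ)) hGn hσ0 hσT
        (by linarith : (0 : ℝ) < S + 1) hh hb (hB (n + m + 1))
      filter_upwards [ae_sub_mem_Ioo_imp (σ := δ * ((n + m + 1 : ℕ) + 1)) h1] with t ht _ hmem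
      have h3 := ht hmem
      simpa only [Pi.zero_apply, zero_mul, mul_zero, integral_zero, add_zero, sub_zero] using h3
    · exact ae_of_all _ fun t h _ => absurd h hσT
  filter_upwards [hae] with t ht n m hage hS'
  have ecast : δ * ((n + m + 1 : ℕ) + 1) = δ * (n + 1) + δ * (m + 1) := by push_cast; ring
  have e2 : t - δ * (n + 1) = (t - δ * ((n + m + 1 : ℕ) + 1)) + δ * (m + 1) := by rw [ecast]; ring
  have hσlt : δ * (m + 1) < t - δ * (n + 1) := by rw [e2]; linarith
  have hσT : δ * (m + 1) < S + 1 := by linarith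
  have hσ0 : 0 ≤ δ * (m + 1) := by positivity
  have hs₀ : 0 ≤ δ * (n + 1) := by positivity
  have hs₁ : 0 ≤ δ * ((n + m + 1 : ℕ) + 1) := by positivity
  have hmem : t - δ * ((n + m + 1 : ℕ) + 1) ∈ Ioo 0 (min (S + 1) (S + 1 - δ * (m + 1))) :=
    ⟨hage, lt_min (by linarith) (by linarith)⟩
  have hbound := ht n m hσT hmem
  have e1 : δ * (m + 1) + (t - δ * ((n + m + 1 : ℕ) + 1)) = t - δ * (n + 1) := by rw [e2]; ring
  rw [e1] at hbound
  -- the enlarged windows are finite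
  obtain ⟨hDafin, -⟩ := (hrel n).toReal_eScalarDissipation_le_half hκ (hh.memLp 2)
    (lintegral_rpow_half_translate_lt_top hG hs₀ (by linarith : (0 : ℝ) < S + 1)) (by linarith : S ≤ S + 1)
  obtain ⟨hDbfin, -⟩ := (hrel (n + m + 1)).toReal_eScalarDissipation_le_half hκ (hh.memLp 2)
    (lintegral_rpow_half_translate_lt_top hG hs₁ (by linarith : (0 : ℝ) < S + 1)) (by linarith : S ≤ S + 1)
  have hDa : eScalarDissipation κ (ϑ n) (δ * (m + 1)) (t - δ * (n + 1)) ≤ eScalarDissipation κ (ϑ n) 0 S := by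
    unfold eScalarDissipation
    exact mul_le_mul' le_rfl (lintegral_mono_set (Ioo_subset_Ioo hσ0 hS'))
  have hDb : eScalarDissipation κ (ϑ (n + m + 1)) 0 (t - δ * ((n + m + 1 : ℕ) + 1)) ≤
      eScalarDissipation κ (ϑ (n + m + 1)) 0 S := by
    unfold eScalarDissipation
    exact mul_le_mul' le_rfl (lintegral_mono_set (Ioo_subset_Ioo_right (by linarith)))
  have hreal := abs_le_two_mul_sqrt_of_pairing hbound hDa hDb hDafin.ne hDbfin.ne
  linarith [(abs_le.1 hreal).2]

end Family

end Torus

end Literature.Analysis.FluidPDE
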